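import Summits.HubbardSuperconductivity.HubbardSuperconductivity.Theses.DeformationLadder
import Summits.HubbardSuperconductivity.HubbardSuperconductivity.Theses.TwistGap

/-!
# Sketch — crux-ideate `stmt-HubbardSuperconductivity-1890` (`LadderThesis`), ideator k = 4, round 2

Card `marginal-rigidity` ("at the marginal dimension the stiffness half of the crux is not an
independent conjecture"): in `d = 2` at `T = 0` a single spontaneously broken `U(1)` is type A;
zero pair stiffness makes its phase mode quadratic-soft, whose zero-point fluctuations are
log-divergent in `d = 2` and destroy the condensate (Watanabe–Murayama PRX 4 (2014) 031057 §6.1;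
the exactly solvable boundary case is the `z = 2` quantum Lifshitz point, algebraic order only,
Ardonne–Fendley–Fradkin 2004).  Hence, conjecturally, `d`-wave pair LRO of the ground states FORCES
zero-momentum selection of every low-energy condensate (`MarginalRigidity` below), and the crux
`LadderThesis ≡ LowEnergyRigidity ≡ TgThesis` is implied by the SUMMIT-side inputs
(`SummitAt ∧ CondensationAt` at one `(U, δ)`) plus that universal implication — without TwistGap's
universal rank-2 crux `TgPairMomentumRigidity` (stmt-1509), which is false on Maxwell intervals where
`LadderThesis` can still hold.

Statements only (`def … : Prop`), nothing proved; everything elaborates.  Layer 1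
(`UncertaintyPrinciple`, `PairDensityCommutator`, `GoldstoneDensityFloor`) is provable now and is
the card's `First lemma`; `MarginalRigidity` is the conjecture; `CruxFromSummitSide` is the glue shape.
Conventions follow route TwistGap: `Δ_d(k) = Σ_x e^{-2πi k·x/L} • localPair d L x` (so
`Δ_d(0) = pairField dWaveFormFactor L`), momenta `k : TorusSite 2 L`, window
`W_K = {k : min (k i) (L - k i) ≤ K}`.
-/

noncomputable section

namespace Summit.HubbardSuperconductivity.HubbardSuperconductivity.Cruxes.LadderThesis.MarginalRigidity

open Literature.MathematicalPhysics.QuantumLattice Literature.Probability.LatticeModels Matrix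
open Summit.HubbardSuperconductivity.HubbardSuperconductivity.Theses
open scoped ComplexOrder BigOperators

/-! ### Layer 0 — the general `T = 0` uncertainty inequality (Pitaevskii–Stringari 1991; Shastry 1992/1997) -/

/-- **Uncertainty principle for a pure state** (Pitaevskii–Stringari, J. Low Temp. Phys. 85 (1991)
377, eq. (4); Shastry, J. Phys. A 30 (1997) L635, ineq. (6)): for ANY square matrices `X, Y` and
ANY vector `φ`,  `|⟨φ, [Xᴴ, Y] φ⟩|² ≤ ⟨φ, {Xᴴ, X} φ⟩ · ⟨φ, {Yᴴ, Y} φ⟩`.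
Proof (three lines): `⟨[Xᴴ,Y]⟩ = ⟨Xφ, Yφ⟩ − ⟨Yᴴφ, Xᴴφ⟩`, two Cauchy–Schwarz, then Cauchy–Schwarz in
`ℝ²`.  No Hermiticity, no normalisation, no ground-state property is used. -/
def UncertaintyPrinciple : Prop :=
  ∀ (n : Type) [Fintype n] [DecidableEq n] (X Y : Matrix n n ℂ) (φ : n → ℂ),
    ‖star φ ⬝ᵥ ((Xᴴ * Y - Y * Xᴴ) *ᵥ φ)‖ ^ 2 ≤
      (star φ ⬝ᵥ ((Xᴴ * X + X * Xᴴ) *ᵥ φ)).re * (star φ ⬝ᵥ ((Yᴴ * Y + Y * Yᴴ) *ᵥ φ)).re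

variable (L : ℕ) [NeZero L]

/-! ### Objects: density waves, pair modes, bond-weighted pair modes, pair weights -/

/-- The density wave `N_k = Σ_x e^{+2πi k·x/L} (n_{x↑} + n_{x↓})` on the fermionic torus
(`N_0 = totalNumber`; `(N_k)ᴴ = N_{-k}`; all `N_k` commute). -/
def densityWave (k : TorusSite 2 L) :
    Matrix (Finset (Orb (FermionTorus 2 L))) (Finset (Orb (FermionTorus 2 L))) ℂ :=
  ∑ x : TorusSite 2 L,
    Complex.exp ((2 * (Real.pi : ℂ) * Complex.I / (L : ℂ)) *
        ((∑ i : Fin 2, (k i).val * (x i).val : ℕ) : ℂ)) •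
      (numberOp (FermionTorus.ofTorusSite x) 0 + numberOp (FermionTorus.ofTorusSite x) 1)

/-- The `d`-wave pair mode `Δ_d(k) = Σ_x e^{-2πi k·x/L} • localPair d L x` (TwistGap's inline
convention verbatim; `Δ_d(0) = pairField dWaveFormFactor L`). -/
def pairMode (k : TorusSite 2 L) :
    Matrix (Finset (Orb (FermionTorus 2 L))) (Finset (Orb (FermionTorus 2 L))) ℂ :=
  ∑ x : TorusSite 2 L,
    Complex.exp (-(2 * (Real.pi : ℂ) * Complex.I / (L : ℂ)) *
        ((∑ i : Fin 2, (k i).val * (x i).val : ℕ) : ℂ)) • localPair dWaveFormFactor L x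

/-- The step phase `e^{2πi k·e/L}` of a lattice step `e : Site 2` (`= Fin 2 → ℤ`). -/
def stepPhase (k : TorusSite 2 L) (e : Site 2) : ℂ :=
  Complex.exp ((2 * (Real.pi : ℂ) * Complex.I / (L : ℂ)) * ((∑ i : Fin 2, ((k i).val : ℤ) * e i : ℤ) : ℂ))

/-- The bond-weighted local `d`-wave pair
`P_x^{(k)} = Σ_e (g_d e/√2) (1 + e^{2πi k·e/L}) (c_{x↑} c_{x+e,↓} − c_{x↓} c_{x+e,↑})`
(`localPair` with the COMPLEX form factor `g_d(e)(1 + e^{ik·e})`; `P_x^{(0)} = 2 P_x`, and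
`‖P_x^{(k)} − 2P_x‖ ≤ C |k|/L`: the bond factor is `O(|k|/L)` off `2`). -/
def bondLocalPair (k x : TorusSite 2 L) :
    Matrix (Finset (Orb (FermionTorus 2 L))) (Finset (Orb (FermionTorus 2 L))) ℂ :=
  ∑ e ∈ insert 0 unitSteps,
    (((dWaveFormFactor e / Real.sqrt 2 : ℝ) : ℂ) * (1 + stepPhase L k e)) •
      (annihilation (orb (FermionTorus.ofTorusSite x) 0) *
          annihilation (orb (FermionTorus.ofTorusSite (x + Torus.proj L e)) 1) -
        annihilation (orb (FermionTorus.ofTorusSite x) 1) *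
          annihilation (orb (FermionTorus.ofTorusSite (x + Torus.proj L e)) 0))

/-- The bond-weighted pair mode `Δ_d^{(k)}(p) = Σ_x e^{-2πi p·x/L} P_x^{(k)}`. -/
def bondPairMode (k p : TorusSite 2 L) :
    Matrix (Finset (Orb (FermionTorus 2 L))) (Finset (Orb (FermionTorus 2 L))) ℂ :=
  ∑ x : TorusSite 2 L,
    Complex.exp (-(2 * (Real.pi : ℂ) * Complex.I / (L : ℂ)) *
        ((∑ i : Fin 2, (p i).val * (x i).val : ℕ) : ℂ)) • bondLocalPair L k x

/-- The `d`-wave pair weight at pair momentum `k`, `P_k(φ) = L⁻⁴ Re⟨φ, Δ_d(k)ᴴ Δ_d(k) φ⟩`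
(`P_0` = the crux's LRO density `L⁻⁴ Re⟨pFᴴ pF⟩`). -/
def pairWeight (k : TorusSite 2 L) (φ : Fock (Orb (FermionTorus 2 L))) : ℝ :=
  (expect ((pairMode L k)ᴴ * pairMode L k) φ).re / (L : ℝ) ^ 4

/-- Membership of a torus momentum in the infrared window `W_K` (TwistGap's filter). -/
def inWindow (K : ℕ) (k : TorusSite 2 L) : Prop := ∀ i : Fin 2, min (k i).val (L - (k i).val) ≤ K

instance (K : ℕ) (k : TorusSite 2 L) : Decidable (inWindow L K k) := by
  unfold inWindow; infer_instance

/-! ### Layer 1 — provable now: the exact commutator and the in-sector Goldstone floor -/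

/-- **Exact pair-mode / density commutator** (CAR algebra on the torus; `[c_x c_y, n_z] =
(δ_{xz} + δ_{yz}) c_x c_y` summed with the phases): for all pair momenta `p` and density momenta `k`,
`[Δ_d(p), N_k] = Δ_d^{(k)}(p − k)` — a pair removed "at `p`" after a density boost by `k` is a pair
removed at `p − k`, with the bond factor `(1 + e^{ik·e})` on the form factor.  This is the hinge that
makes the commutator in the uncertainty inequality MACROSCOPIC on condensed states:
`[Δ_d(0)ᴴ Δ_d(q), N_q] = Δ_d(0)ᴴ Δ_d^{(q)}(0) − (Δ_d^{(−q)}(q))ᴴ Δ_d(q) ≈ 2 L⁴ (P_0 − P_q)`.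
Checked numerically on the `L = 2, 3` tori for all `(p,k)` (job j017513). -/
def PairDensityCommutator : Prop :=
  ∀ (L : ℕ) [NeZero L] (p k : TorusSite 2 L),
    pairMode L p * densityWave L k - densityWave L k * pairMode L p = bondPairMode L k (p - k)

/-- **In-sector Goldstone floor** (LRO forces conjugate density fluctuations; provable now from
`UncertaintyPrinciple` with `X = Δ_d(q)ᴴ Δ_d(0)`, `Y = N_q`, `PairDensityCommutator`, the trivial
norm bounds `‖Δ_d(k)‖² ≤ 32 L⁴ (+O(L²))`, `‖P_x^{(k)} − 2 P_x‖ ≤ C|k|/L`, and `{N_qᴴ, N_q} =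
2 N_{−q} N_q`): there is an absolute `C` such that for every side `L`, window `K`, momentum
`0 ≠ q ∈ W_K` and every UNIT Fock vector `φ` (no sector, no Hamiltonian),
`((P_0(φ) − P_q(φ) − C K / L)₊)² ≤ 16 (P_0(φ) + P_q(φ)) · Re⟨φ, N_{−q} N_q φ⟩`.
In words: a state with `d`-wave LRO `P_0 ≥ a` carries, at EVERY nonzero infrared momentum `q`,
either macroscopic displaced pair weight `P_q ≥ a/2` or total density fluctuation
`⟨N_{−q}N_q⟩ ≥ a/200` — the charge sector cannot be frozen where the pair phase is ordered.  For
sector GROUND states the moment inequality `m₀² ≤ m₁ m₋₁` with the exactly computable f-sum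
`m₁ = ½⟨[N_{−q},[H,N_q]]⟩ ≤ 4(2πK/L)²|⟨T⟩| = O(K²)` turns it into a compressibility floor
`χ_L(q) ≥ c a² / K²` and a Feynman ceiling `E₁(P₀+q) − E₀ ≤ C' K²/a` on the in-sector gap at
momentum transfer `q` (the phase phonon exists, in-sector, as a theorem).  With the clustering
hypothesis `Var_φ(P_0) → 0` (self-averaging of the condensate, TgExactRate's clause) the same
inequality sharpens to `P_q · ⟨N_{−q}N_q⟩ ≥ c m² L²·L⁻²…`, i.e. `P_q ≥ c m² /(L² S_N(q))` —
the `1/|q|L` Goldstone share of every phase mode. -/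
def GoldstoneDensityFloor : Prop :=
  ∃ C : ℝ, 0 < C ∧ ∀ (L : ℕ) [NeZero L] (K : ℕ) (q : TorusSite 2 L), q ≠ 0 → inWindow L K q →
    ∀ φ : Fock (Orb (FermionTorus 2 L)), star φ ⬝ᵥ φ = 1 →
      (max (pairWeight L 0 φ - pairWeight L q φ - C * K / L) 0) ^ 2 ≤
        16 * (pairWeight L 0 φ + pairWeight L q φ) *
          (expect (densityWave L (-q) * densityWave L q) φ).re

/-! ### Layer 2 — the conjecture: marginal-dimension rigidity (zero-momentum selection from LRO) -/

/-- `S` at a fixed `(U, δ)` with a uniform constant: every normalised `(N_L, S^z = 0)`-sector ground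
state of the pure model at every large even `L` has `d`-wave LRO density `≥ a`.  (`S` ⇔
`∃ U δ a, SummitAt U δ a` by a diagonal-sequence argument.) -/
def SummitAt (U δ a : ℝ) : Prop :=
  ∃ L₁ : ℕ, ∀ (L : ℕ) [NeZero L], L₁ ≤ L → Even L →
    ∀ ψ : Fock (Orb (FermionTorus 2 L)), star ψ ⬝ᵥ ψ = 1 →
      IsGroundStateInSector (hubbardTorus 2 L 1 U) (2 * ⌊(1 - δ) * (L : ℝ) ^ 2 / 2⌋₊) 0 ψ →
        a ≤ pairWeight L 0 ψ

/-- TwistGap's `TgLowEnergyCondensation` (stmt-1510) AT a given `(U, δ)` (its body without the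
leading `∃ U δ`): every sector state within total energy `Γ` of `E₀` carries window pair weight `≥ θ`. -/
def CondensationAt (U δ : ℝ) : Prop :=
  ∃ K : ℕ, ∃ θ : ℝ, 0 < θ ∧ ∃ Γ : ℝ, 0 < Γ ∧ ∃ L₀ : ℕ, ∀ (L : ℕ) [NeZero L], L₀ ≤ L → Even L →
    ∀ φ : Fock (Orb (FermionTorus 2 L)),
      φ ∈ szSector (2 * ⌊(1 - δ) * (L : ℝ) ^ 2 / 2⌋₊) 0 → star φ ⬝ᵥ φ = 1 →
      (expect (hubbardTorus 2 L 1 U) φ).re ≤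
          (hubbardTorus 2 L 1 U).minEnergyOn (szSector (2 * ⌊(1 - δ) * (L : ℝ) ^ 2 / 2⌋₊) 0) + Γ →
        θ ≤ ∑ k ∈ Finset.univ.filter (fun k : TorusSite 2 L => inWindow L K k), pairWeight L k φ

/-- **MARGINAL RIGIDITY** (the card's conjecture; universal in `(U, δ)`, no witness).  If at some
`(U, δ)` every sector ground state has `d`-wave LRO `≥ a` at `k = 0`, then low-energy states that are
condensed SOMEWHERE in an infrared window are condensed AT ZERO: for every window `K` and floor `θ`
there are `κ, a' > 0` such that every unit sector state within `κ` of `E₀` with window pair weight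
`≥ θ` has `P_0 ≥ a'`.  Heuristic: a violating sequence is a soft twisted/phase-modulated condensate,
i.e. vanishing pair stiffness; in `d = 2` at `T = 0` a type-A Goldstone mode with vanishing
stiffness is `z ≥ 2`-soft and its zero-point phase fluctuations `∫ d²q /(L² ω_q χ) ∼ ∫ d²q/q²`
diverge logarithmically, destroying the very LRO assumed (Watanabe–Murayama 2014 §6.1 "type-A NGBs
with a quadratic dispersion … destroy the order parameter if d ≤ 2"; quantum Lifshitz point =
algebraic order).  False in `d = 3` (Lifshitz points keep LRO); the loophole in `d = 2` is a
fractional-power phase dispersion `ω ∼ q^z`, `1 < z < 2`, which needs a non-local effective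
phase action from other gapless modes (Watanabe–Murayama PRD 89 (2014) 101701). -/
def MarginalRigidity : Prop :=
  ∀ (U : ℝ), 0 < U → ∀ δ ∈ Set.Ioo (0:ℝ) (1 / 2), ∀ a : ℝ, 0 < a → SummitAt U δ a →
    ∀ (K : ℕ) (θ : ℝ), 0 < θ → ∃ κ : ℝ, 0 < κ ∧ ∃ a' : ℝ, 0 < a' ∧ ∃ L₀ : ℕ,
      ∀ (L : ℕ) [NeZero L], L₀ ≤ L → Even L →
        ∀ φ : Fock (Orb (FermionTorus 2 L)),
          φ ∈ szSector (2 * ⌊(1 - δ) * (L : ℝ) ^ 2 / 2⌋₊) 0 → star φ ⬝ᵥ φ = 1 →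
          (expect (hubbardTorus 2 L 1 U) φ).re ≤
              (hubbardTorus 2 L 1 U).minEnergyOn (szSector (2 * ⌊(1 - δ) * (L : ℝ) ^ 2 / 2⌋₊) 0) + κ →
          θ ≤ (∑ k ∈ Finset.univ.filter (fun k : TorusSite 2 L => inWindow L K k), pairWeight L k φ) →
            a' ≤ pairWeight L 0 φ

/-! ### Glue shape (finite-dimensional bookkeeping, provable once typed against the route decls) -/

/-- **Crux from the summit side.**  `MarginalRigidity` + (`S` and window condensation AT THE SAME
`(U, δ)`) ⇒ `LowEnergyRigidity` (choose `κ' := min κ Γ`, `a'`), hence `LadderThesis` by the landed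
`RigidityGlue` (p… rigidityGlue_proof) with `StiffnessImpliesPenalised`, `PenalisedGroundStateExists`.
The only non-definitional step is `pairWeight L 0 φ = L⁻⁴ Re⟨φ, pFᴴ pF φ⟩` (`pairMode L 0 =
pairField dWaveFormFactor L`: all phases are `1`). -/
def CruxFromSummitSide : Prop :=
  MarginalRigidity →
    (∃ U : ℝ, 0 < U ∧ ∃ δ ∈ Set.Ioo (0:ℝ) (1 / 2), ∃ a : ℝ, 0 < a ∧ SummitAt U δ a ∧ CondensationAt U δ) →
      DeformationLadder.LowEnergyRigidity

/-- … and the crux itself. -/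
def CruxFromSummitSide' : Prop :=
  MarginalRigidity →
    (∃ U : ℝ, 0 < U ∧ ∃ δ ∈ Set.Ioo (0:ℝ) (1 / 2), ∃ a : ℝ, 0 < a ∧ SummitAt U δ a ∧ CondensationAt U δ) →
      DeformationLadder.LadderThesis

end Summit.HubbardSuperconductivity.HubbardSuperconductivity.Cruxes.LadderThesis.MarginalRigidity
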